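import Summits.QuantumFields.YangMills.Theorems.WeakCouplingRatesColdBoxGauss3LargeField

/-!
# Crux `BulkDominatesColdBoxW` (stmt-QuantumFields-19609), expansion stubs with a boundary datum: the SHIFTED small-field event of the three-colour
# Dirichlet Gaussian (helper H-T5, Gaussian half)

With a datum the Gaussian reference is `boxDirichlet H ^{⊗3}` shifted by background circulations `F_c(r)`; the small-field event read in the shifted
variables is `{∀ c r, |F_c(r) + s_c(r)| ≤ R}`.  If every background circulation is at most `R/2` (from the ENERGY of the datum,
`dirBackground_sq_le_formM`: in Gaussian units `√(2β)|F̄| ≲ H²β^{δ} ≪ β^{ε}/2`), its complement has mass at most that of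
`{¬ ∀ c r, |s_c(r)| ≤ R/2}`, i.e. `≤ 3·240(2H+1)⁴e^{−(R/2)²/2}` (`measureReal_gauss3_not_smallField_le`).  Typed signature = the stub-ideation
sketch `Sketch-sidea-k1-r3.lean` (item evidence #33 on stmt-QuantumFields-19609), `measureReal_pi_not_shiftedSmallField_le`.

Fleet seat `ym-spine-20043-p1` (g3; Gaussian side of the work split with `ym-wcr-19609-p1`).  No sorry, standard axioms, no new definition, no named-fact
hypothesis.  NOT a claim about the mass gap.
-/

set_option autoImplicit false

noncomputable section

open MeasureTheory Finset Real
open Literature.Probability.LatticeModels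
open Literature.MathematicalPhysics.QuantumLattice
open Literature.MathematicalPhysics.QuantumFieldTheory
open Literature.MathematicalPhysics.QuantumFieldTheory.LatticeMaxwell
open Literature.MathematicalPhysics.QuantumFieldTheory.AxialGauge

namespace Summit.QuantumFields.YangMills.Theorems.WeakCouplingRates

/-- **H-T5, Gaussian half with shift**: if every background circulation is at most `R/2` in absolute value, the shifted small-field event
`{∀ c r, |F_c(r) + s_c(r)| ≤ R}` fails with `boxDirichlet H ^{⊗3}`-probability at most `3·240(2H+1)⁴e^{−(R/2)²/2}`. -/
theorem measureReal_pi_not_shiftedSmallField_le (H : ℕ) (F : Fin 3 → ZdPlaquette 4 → ℝ) {R : ℝ} (hR : 0 ≤ R)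
    (hF : ∀ c (r : ZdPlaquette 4), |F c r| ≤ R / 2) :
    (Measure.pi fun _ : Fin 3 => boxDirichlet H).real
        {t | ¬ ∀ (c : Fin 3) (r : ZdPlaquette 4), |F c r + dirCirc H (r.1, r.2.1.1, r.2.1.2) (t c)| ≤ R} ≤
      3 * (240 * (2 * (H : ℝ) + 1) ^ 4 * Real.exp (-(R / 2) ^ 2 / 2)) := by
  have hsub : {t : TSpace H | ¬ ∀ (c : Fin 3) (r : ZdPlaquette 4), |F c r + dirCirc H (r.1, r.2.1.1, r.2.1.2) (t c)| ≤ R} ⊆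
      {t | ¬ ∀ (c : Fin 3) (r : ZdPlaquette 4), |dirCirc H (r.1, r.2.1.1, r.2.1.2) (t c)| ≤ R / 2} := by
    intro t ht hsmall
    apply ht
    intro c r
    calc |F c r + dirCirc H (r.1, r.2.1.1, r.2.1.2) (t c)| ≤ |F c r| + |dirCirc H (r.1, r.2.1.1, r.2.1.2) (t c)| := abs_add_le _ _
      _ ≤ R / 2 + R / 2 := add_le_add (hF c r) (hsmall c r)
      _ = R := by ring
  have h := measureReal_gauss3_not_smallField_le H (R := R / 2) (by linarith)
  calc (Measure.pi fun _ : Fin 3 => boxDirichlet H).real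
        {t | ¬ ∀ (c : Fin 3) (r : ZdPlaquette 4), |F c r + dirCirc H (r.1, r.2.1.1, r.2.1.2) (t c)| ≤ R}
      ≤ (Measure.pi fun _ : Fin 3 => boxDirichlet H).real
          {t | ¬ ∀ (c : Fin 3) (r : ZdPlaquette 4), |dirCirc H (r.1, r.2.1.1, r.2.1.2) (t c)| ≤ R / 2} := measureReal_mono hsub
    _ ≤ 720 * (2 * (H : ℝ) + 1) ^ 4 * Real.exp (-(R / 2) ^ 2 / 2) := h
    _ = 3 * (240 * (2 * (H : ℝ) + 1) ^ 4 * Real.exp (-(R / 2) ^ 2 / 2)) := by ring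

end Summit.QuantumFields.YangMills.Theorems.WeakCouplingRates

end
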